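import Mathlib
import Literature.NumberTheory.LFunctions.Zhang2022.Section18Sj23SecondLine
import Literature.NumberTheory.LFunctions.Zhang2022.Section18RangeEdgesRelW
import Literature.NumberTheory.LFunctions.Zhang2022.SkeletonMainOrderEndgame
import Literature.NumberTheory.LFunctions.Zhang2022.Section7Prop71Holds
import Literature.NumberTheory.LFunctions.Zhang2022.Section8Lemma81FromProp22
import Literature.NumberTheory.LFunctions.Zhang2022.Section2Lemma23Holds
import Literature.NumberTheory.LFunctions.Zhang2022.Section10Lemma101
import Literature.NumberTheory.LFunctions.Zhang2022.Section10Lemma102RelWHolds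
import Literature.NumberTheory.LFunctions.Zhang2022.AppendixALemma83RelHolds
import HarnessLib

/-!
# Zhang (2022) §18, proof of (2.33): `Ξ_J = C₂₃₃𝔞𝔓 + o(𝔓)` with the SHARP constant `C₂₃₃`, and the
# RT-08 node `Skeleton.Ineq233With c′ C233` from the relative Lemma 10.2 of record

Topic `Literature/NumberTheory/LFunctions/Zhang2022` (Landau–Siegel audit tree; verdict-neutral).
Y. Zhang, *Discrete mean estimates and the Landau–Siegel zero*, arXiv:2211.02515v1 (2022)
[Zhang2022LandauSiegel], §18 pp. 99–101, "Proof of (2.33)": "By Lemma 8.1, (18.3). … This yields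
(2.33) by Lemma 8.1 and Proposition 7.1" — **an unrefereed manuscript under adjudication; nothing in
this file asserts any claim of the manuscript.** Lane ZHANG-L (strike seat zl-closer-2), rulings
R-35/R-35d (RT-08): the terminal theorem of record `theorem1_of_sec18E` takes the §18 estimate E-105
`MainOrderContradiction (c232E e1ppD k) cJ` with `cJ` = the sharpest constant for which the (2.33)-node
`Skeleton.Ineq233With c′ cJ` (`∀ η > 0`, eventually under (A), `Ξ_J ≤ (c_J + η)𝔞𝔓`) is PROVED from
the leaves. The landed chain (`Skeleton.ded183RelW_holds`) gives the printed CRUDE `cJ = 8800/π`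
(through u013/u014); this file gives §18's OWN main-term constant
`C₂₃₃ = 2Re{½d₇₁ + 2d₇₂ + 3⁄2d₇₃} ≈ 2546.85` (`Section10Defs.C233`), from the SAME four inputs the
skeleton already holds as theorems or binders — (18.3) `Eq183`, Proposition 7.1 `Prop71`, Lemma 10.1,
and Lemma 10.2 in the relative-weighted reading of record `Skeleton.Lemma102RelW` (RT-01′):

* `sj23_eval_of_ranges` — **`S_j(𝐚₂₃,𝐚₂₃) = α𝔞·d₇ⱼ + o(α)`** from the printed expansion/split
  (u008/u009, tree theorems), the three range claims (`Step18_range1`, `Step18_u010`, `Step18_u011b`,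
  hypotheses here) and the two second lines of `Section18Sj23SecondLine`;
* `xiJ_eval_C233_of_steps` — **`|Ξ_J − C₂₃₃𝔞𝔓| ≤ ε𝔓`** eventually, from (18.3), Prop. 7.1
  (`mainMV = α⁻¹(½S₁ + 2S₂ + 3⁄2S₃)𝔓`), the `S_j` evaluation and the negligibility of Prop. 7.1's
  error term `E(𝐚₂₃,𝐚₂₃)` (pure `ε`-bookkeeping, as in `Sec18Ded183.bound183_of_steps`);
* `xiJ_eval_C233_of_rel` / `_of_relD3` — the same from `Eq183`, `Prop71`, `Lemma101` and the two
  relative Lemma-10.2 clause bundles (the range claims being `step18_range1/u010/u011b_of_rel` of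
  `Section18RangeEdgesRelW`, the error-term control `ecal23Negligible_of_sjNorm ∘ sjNorm_of_ranges`);
* **`Skeleton.xiJ_evalC233_of_lemma102RelW`**: `Eq183 c′ → Prop71 c′ → Lemma101 c′ →
  Skeleton.Lemma102RelW c′ → (∀ ε > 0, ForAllLarge, (A) → |Ξ_J − C233·𝔞𝔓| ≤ ε𝔓)`;
* **`Skeleton.bound183With_C233`**: same hypotheses `→ (∀ ε > 0, ForAllLarge, (A) → Ξ_J ≤ C233·𝔞𝔓 + ε𝔓)`
  (the sharp twin of `Skeleton.Bound183` = the `8800/π` instance);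
* **`Skeleton.ineq233With_C233 : Eq183 c′ → Prop71 c′ → Lemma101 c′ → Skeleton.Lemma102RelW c′ →
  Skeleton.Ineq233With c′ C233`** — the RT-08 node of record at `cJ = C233`, via the endgame's
  `ineq233With_of_bound` and Lemma 5.7 `frakALowerBound_holds`; same four antecedents as
  `Skeleton.Ded183RelW`, so the skeleton plugs it with the terms it already builds
  (`hE183 h71 h101 h102`);
* (revision 2) **`Skeleton.ineq233With_C233_of_prop22 (hc′ : 0 ≤ c′) (h22 : Prop22 c′) :
  Ineq233With c′ C233`** and `Skeleton.xiJ_evalC233_of_prop22` — the same with every antecedent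
  supplied by tree theorems (`eq183_of`, `prop71X_holds`, `lemma101_holds`,
  `lemma102RelW_of_lemma83Rel ∘ lemma83Rel_holds`).

Theorem-only (0 definitions, 0 new facts). vs PRINT: `C₂₃₃ < 8800/π`, so `Ineq233With c′ C233` is
STRONGER than the printed-crude instance and is what §18's displayed computation actually yields; the
hypothesis `MainOrderContradiction (…) C233` of the terminal is thereby WEAKER (still refuted as
instantiated, `not_mainOrderContradiction_cD_record`). WHAT THIS IS NOT: a proof of (18.3),
Proposition 7.1, Lemmas 10.1–10.2, or of anything about Theorems 1–2 / Landau–Siegel zeros.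

## References

* Y. Zhang, arXiv:2211.02515v1 (2022), §18 pp. 99–101, (18.3), (2.33); §7 Prop. 7.1; §10 Lemmas
  10.1–10.2; §2 (2.10), (2.31); §5 Lemma 5.7. [cite: Zhang2022LandauSiegel, §18 pp.99–101]
-/

noncomputable section

open Complex Real ComplexConjugate MeasureTheory
open Literature.NumberTheory.LFunctions.Zhang2022.Skeleton

namespace Literature.NumberTheory.LFunctions.Zhang2022.Typed.Section18

open Typed.Sec10C (yyJ1 yyJ2)

variable (c' : ℝ)

/-! ## (f) `S_j(𝐚₂₃,𝐚₂₃) = α𝔞·d₇ⱼ + o(α)` -/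

/-- Norm of a five-term sum. [folklore] -/
private theorem norm_add5_le' (a b c d e : ℂ) : ‖a + b + c + d + e‖ ≤ ‖a‖ + ‖b‖ + ‖c‖ + ‖d‖ + ‖e‖ := by
  have h1 := norm_add_le (a + b + c + d) e
  have h2 := norm_add_le (a + b + c) d
  have h3 := norm_add_le (a + b) c
  have h4 := norm_add_le a b
  linarith

/-- **`S_j(𝐚₂₃,𝐚₂₃) = α𝔞·d₇ⱼ + o(α)`** (Z22 p.100, the displayed evaluation of `S_j(𝐚₂₃,𝐚₂₃)` carried
to its `z`-integral main term): from the printed expansion u008 and split u009 (tree theorems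
`step18_u008_holds`, `step18_u009_holds`, taken as hypotheses to keep the statement generic), the
three range claims `Step18_range1` (`o(α)`), `Step18_u010`, `Step18_u011b`, and the second lines
`main18u010_secondLine`, `main18u011b_secondLine` with `α⁻¹·(250000𝔞/log P)(∫₁+∫₂) = 𝔞·d7F`
(`secondLine_main_eq_d7F`): for every `ε > 0`, eventually under (A), `j ∈ {1,2,3}`,
`‖S_j(𝐚₂₃,𝐚₂₃) − α·𝔞·d7F j 𝔶𝔶₁ⱼ 𝔶𝔶₂ⱼ‖ ≤ εα`. [cite: Zhang2022LandauSiegel, §18 p.100] -/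
theorem sj23_eval_of_ranges (h8 : Step18_u008 c') (h9 : Step18_u009 c') (hr1 : Step18_range1 c')
    (h10 : Step18_u010 c') (h11 : Step18_u011b c') :
    ∀ ε : ℝ, 0 < ε → ForAllLarge fun D _ χ => AssumptionA D χ → ∀ j ∈ ({1, 2, 3} : Finset ℕ),
      ‖Sj c' D j (a23 χ) (a23 χ) -
          (alpha D : ℂ) * (frakA χ : ℂ) * d7F j (yyJ1 j) (yyJ2 j)‖ ≤ ε * alpha D := by
  intro ε hε
  have hε5 : 0 < ε / 5 := by positivity
  have H := ((((((h8.and h9).and (hr1 _ hε5)).and (h10 _ hε5)).and (h11 _ hε5)).and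
    (main18u010_secondLine c' _ hε5)).and (main18u011b_secondLine c' _ hε5)).and
    (Typed.Sec10C.forAllLarge_ell_six c')
  refine H.mono ?_
  intro D _ χ hq hp ⟨⟨⟨⟨⟨⟨⟨e8, e9⟩, r1⟩, r10⟩, r11⟩, s10⟩, s11⟩, hℓ6, _⟩ hA j hj
  have hℓ0 : 0 < ell D := by linarith [hℓ6]
  have hlogP : Real.log (bigP D) = ell D ^ 9 := by rw [bigP, Real.log_exp]
  have hΛ : 0 < Real.log (bigP D) := by rw [hlogP]; positivity
  have hα : 0 < alpha D := Typed.Sec10C.alpha_pos hΛ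
  have hα0 : (alpha D : ℂ) ≠ 0 := by exact_mod_cast hα.ne'
  -- the main term as `α·(α⁻¹(I₁ + I₂))`
  set I₁ : ℂ := 250000 * (frakA χ : ℂ) / (Real.log (bigP D) : ℂ) *
    ∫ z in (0.5 : ℝ)..0.502, (-1 - π * I * j * ((z - 0.5 : ℝ) : ℂ)) * (-1 + yyJ1 j z) with hI₁
  set I₂ : ℂ := 250000 * (frakA χ : ℂ) / (Real.log (bigP D) : ℂ) *
    ∫ z in (0.502 : ℝ)..0.504, (1 - π * I * j * ((0.504 - z : ℝ) : ℂ)) * (1 + yyJ2 j z) with hI₂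
  have hmain : (alpha D : ℂ) * (frakA χ : ℂ) * d7F j (yyJ1 j) (yyJ2 j) = I₁ + I₂ := by
    have h := secondLine_main_eq_d7F χ j hΛ
    rw [← hI₁, ← hI₂] at h
    calc (alpha D : ℂ) * (frakA χ : ℂ) * d7F j (yyJ1 j) (yyJ2 j)
        = (alpha D : ℂ) * ((alpha D : ℂ)⁻¹ * (I₁ + I₂)) := by rw [h]; ring
      _ = I₁ + I₂ := by field_simp
  -- decomposition of `S_j − (I₁ + I₂)`
  set R1 : ℂ := Sj23Range c' χ j 0 (bigP D ^ (0.5 : ℝ)) with hR1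
  set R2 : ℂ := Sj23Range c' χ j (bigP D ^ (0.5 : ℝ)) (bigP D ^ (0.502 : ℝ)) with hR2
  set R3 : ℂ := Sj23Range c' χ j (bigP D ^ (0.502 : ℝ)) (bigP D ^ (0.504 : ℝ)) with hR3
  have eS : Sj c' D j (a23 χ) (a23 χ) = R1 + R2 + R3 := by rw [e8 j hj, e9 j hj]
  have key : Sj c' D j (a23 χ) (a23 χ) - (alpha D : ℂ) * (frakA χ : ℂ) * d7F j (yyJ1 j) (yyJ2 j) =
      R1 + (R2 - main18u010 c' χ j) + (R3 - main18u011b c' χ j) + (main18u010 c' χ j - I₁) +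
        (main18u011b c' χ j - I₂) := by
    rw [eS, hmain]; ring
  rw [key]
  calc ‖R1 + (R2 - main18u010 c' χ j) + (R3 - main18u011b c' χ j) + (main18u010 c' χ j - I₁) +
        (main18u011b c' χ j - I₂)‖
      ≤ ‖R1‖ + ‖R2 - main18u010 c' χ j‖ + ‖R3 - main18u011b c' χ j‖ + ‖main18u010 c' χ j - I₁‖ +
          ‖main18u011b c' χ j - I₂‖ := norm_add5_le' _ _ _ _ _
    _ ≤ ε / 5 * alpha D + ε / 5 * alpha D + ε / 5 * alpha D + ε / 5 * alpha D + ε / 5 * alpha D := by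
        gcongr
        · exact r1 hA j hj
        · exact r10 hA j hj
        · exact r11 hA j hj
        · exact s10 hA j hj
        · exact s11 hA j hj
    _ = ε * alpha D := by ring

/-! ## (g) `Ξ_J = C₂₃₃𝔞𝔓 + o(𝔓)` -/

/-- The weighted combination of the `d7F` at the printed profiles, `M₇ := ½·d7F 1 + 2·d7F 2 + 3⁄2·d7F 3`,
and the `j`-wise error bookkeeping: if `‖S_j − α𝔞·d7F j‖ ≤ δα` for `j = 1, 2, 3` then
`‖α⁻¹(½S₁ + 2S₂ + 3⁄2S₃) − 𝔞·M₇‖ ≤ 4δ`. [cite: Zhang2022LandauSiegel, §18 p.100; §7 Prop. 7.1] -/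
theorem combination_eval {D : ℕ} (hα : 0 < alpha D) {S₁ S₂ S₃ : ℂ} {A δ : ℝ}
    (h1 : ‖S₁ - (alpha D : ℂ) * (A : ℂ) * d7F 1 (yyJ1 1) (yyJ2 1)‖ ≤ δ * alpha D)
    (h2 : ‖S₂ - (alpha D : ℂ) * (A : ℂ) * d7F 2 (yyJ1 2) (yyJ2 2)‖ ≤ δ * alpha D)
    (h3 : ‖S₃ - (alpha D : ℂ) * (A : ℂ) * d7F 3 (yyJ1 3) (yyJ2 3)‖ ≤ δ * alpha D) :
    ‖(alpha D : ℂ)⁻¹ * (1 / 2 * S₁ + 2 * S₂ + 3 / 2 * S₃) -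
        (A : ℂ) * (1 / 2 * d7F 1 (yyJ1 1) (yyJ2 1) + 2 * d7F 2 (yyJ1 2) (yyJ2 2) +
          3 / 2 * d7F 3 (yyJ1 3) (yyJ2 3))‖ ≤ 4 * δ := by
  have hα0 : (alpha D : ℂ) ≠ 0 := by exact_mod_cast hα.ne'
  set r₁ : ℂ := S₁ - (alpha D : ℂ) * (A : ℂ) * d7F 1 (yyJ1 1) (yyJ2 1) with hr₁
  set r₂ : ℂ := S₂ - (alpha D : ℂ) * (A : ℂ) * d7F 2 (yyJ1 2) (yyJ2 2) with hr₂
  set r₃ : ℂ := S₃ - (alpha D : ℂ) * (A : ℂ) * d7F 3 (yyJ1 3) (yyJ2 3) with hr₃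
  have e : (alpha D : ℂ)⁻¹ * (1 / 2 * S₁ + 2 * S₂ + 3 / 2 * S₃) -
      (A : ℂ) * (1 / 2 * d7F 1 (yyJ1 1) (yyJ2 1) + 2 * d7F 2 (yyJ1 2) (yyJ2 2) +
        3 / 2 * d7F 3 (yyJ1 3) (yyJ2 3)) =
      (alpha D : ℂ)⁻¹ * (1 / 2 * r₁ + 2 * r₂ + 3 / 2 * r₃) := by
    rw [hr₁, hr₂, hr₃]; field_simp; ring
  rw [e, norm_mul, norm_inv, Complex.norm_real, Real.norm_eq_abs, abs_of_pos hα]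
  have hsum : ‖1 / 2 * r₁ + 2 * r₂ + 3 / 2 * r₃‖ ≤ 4 * (δ * alpha D) := by
    calc ‖1 / 2 * r₁ + 2 * r₂ + 3 / 2 * r₃‖ ≤ ‖1 / 2 * r₁‖ + ‖2 * r₂‖ + ‖3 / 2 * r₃‖ := norm_add₃_le
      _ = 1 / 2 * ‖r₁‖ + 2 * ‖r₂‖ + 3 / 2 * ‖r₃‖ := by
          rw [norm_mul, norm_mul, norm_mul]; norm_num
      _ ≤ 1 / 2 * (δ * alpha D) + 2 * (δ * alpha D) + 3 / 2 * (δ * alpha D) := by gcongr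
      _ = 4 * (δ * alpha D) := by ring
  calc (alpha D)⁻¹ * ‖1 / 2 * r₁ + 2 * r₂ + 3 / 2 * r₃‖ ≤ (alpha D)⁻¹ * (4 * (δ * alpha D)) :=
        mul_le_mul_of_nonneg_left hsum (inv_nonneg.mpr hα.le)
    _ = 4 * δ := by field_simp

/-- **`|Ξ_J − C₂₃₃𝔞𝔓| ≤ ε𝔓` eventually** (Z22 p.100, "This yields (2.33) by Lemma 8.1 and Proposition
7.1", with §18's own main-term constant): from (18.3) `Eq183` (`Ξ_J = 2Re Θ₁(𝐚₂₃,𝐚₂₃) + o(𝔓)`),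
Proposition 7.1 at `𝐚₁ = 𝐚₂ = 𝐚₂₃` (`Θ₁ = α⁻¹(½S₁+2S₂+3⁄2S₃)𝔓 + O(E) + o(𝔓)`, admissibility
`Skeleton.adm72_a23`), the evaluation `S_j = α𝔞d₇ⱼ + o(α)` (hypothesis `hS`, = `sj23_eval_of_ranges`)
and `E(𝐚₂₃,𝐚₂₃) = o(𝔓)` (hypothesis `hE`): `2Re{(½d₇₁+2d₇₂+3⁄2d₇₃)𝔞} = C₂₃₃𝔞`
(`combination_d7F_re_eq_C233`). Pure `ε`-bookkeeping. [cite: Zhang2022LandauSiegel, §18 p.100, (18.3), (2.33)] -/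
theorem xiJ_eval_C233_of_steps (h183 : Eq183 c') (h71 : Prop71 c')
    (hS : ∀ ε : ℝ, 0 < ε → ForAllLarge fun D _ χ => AssumptionA D χ → ∀ j ∈ ({1, 2, 3} : Finset ℕ),
      ‖Sj c' D j (a23 χ) (a23 χ) -
          (alpha D : ℂ) * (frakA χ : ℂ) * d7F j (yyJ1 j) (yyJ2 j)‖ ≤ ε * alpha D)
    (hE : ∀ ε : ℝ, 0 < ε → ForAllLarge fun D _ χ => AssumptionA D χ →
      Ecal c' D (a23 χ) (a23 χ) ≤ ε * frakP D) :
    ∀ ε : ℝ, 0 < ε → ForAllLarge fun D _ χ => AssumptionA D χ →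
      |xiJ c' χ - C233 * frakA χ * frakP D| ≤ ε * frakP D := by
  intro ε hε
  obtain ⟨C, h71'⟩ := h71 1 (ε / 12) (by positivity)
  have hC1 : 0 < |C| + 1 := by positivity
  have H := ((((h183 (ε / 3) (by positivity)).and h71').and (hS (ε / 24) (by positivity))).and
    (hE (ε / (12 * (|C| + 1))) (by positivity))).and (Typed.Sec10C.forAllLarge_ell_six c')
  refine H.mono ?_
  intro D _ χ hq hp ⟨⟨⟨⟨h183D, h71D⟩, hSD⟩, hED⟩, hℓ6, _⟩ hA
  have hℓ0 : 0 < ell D := by linarith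
  have hlog2 : 2 ≤ Real.log D := by show 2 ≤ ell D; linarith
  have hlogP : Real.log (bigP D) = ell D ^ 9 := by rw [bigP, Real.log_exp]
  have hΛ : 0 < Real.log (bigP D) := by rw [hlogP]; positivity
  have hα : 0 < alpha D := Typed.Sec10C.alpha_pos hΛ
  have hP : 0 ≤ frakP D := frakP_nonneg D
  -- Prop. 7.1 at `𝐚₂₃, 𝐚₂₃`
  have hadm : Adm72 D 1 (a23 χ) := adm72_a23 χ hlog2
  have e1 : ‖Theta1 c' χ (a23 χ) (a23 χ) - mainMV c' D (a23 χ) (a23 χ)‖ ≤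
      C * Ecal c' D (a23 χ) (a23 χ) + ε / 12 * frakP D := h71D hA (a23 χ) (a23 χ) hadm hadm
  have e3 : Ecal c' D (a23 χ) (a23 χ) ≤ ε / (12 * (|C| + 1)) * frakP D := hED hA
  have hEnn : 0 ≤ Ecal c' D (a23 χ) (a23 χ) := by
    unfold Ecal
    exact mul_nonneg (mul_nonneg hP (sq_nonneg _)) (by positivity)
  have e4 : C * Ecal c' D (a23 χ) (a23 χ) ≤ ε / 12 * frakP D := by
    have k1 : C * Ecal c' D (a23 χ) (a23 χ) ≤ |C| * Ecal c' D (a23 χ) (a23 χ) :=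
      mul_le_mul_of_nonneg_right (le_abs_self C) hEnn
    have k2 : |C| * Ecal c' D (a23 χ) (a23 χ) ≤ |C| * (ε / (12 * (|C| + 1)) * frakP D) :=
      mul_le_mul_of_nonneg_left e3 (abs_nonneg C)
    have key : |C| * (ε / (12 * (|C| + 1))) ≤ ε / 12 := by
      have e : |C| * (ε / (12 * (|C| + 1))) = ε / 12 * (|C| / (|C| + 1)) := by
        field_simp
      rw [e]
      exact mul_le_of_le_one_right (by positivity) ((div_le_one hC1).mpr (by linarith))
    have k3 : |C| * (ε / (12 * (|C| + 1)) * frakP D) ≤ ε / 12 * frakP D := by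
      rw [← mul_assoc]
      exact mul_le_mul_of_nonneg_right key hP
    linarith
  -- hence `‖Θ₁ − mainMV‖ ≤ (ε/6)𝔓`
  have e5 : ‖Theta1 c' χ (a23 χ) (a23 χ) - mainMV c' D (a23 χ) (a23 χ)‖ ≤ ε / 6 * frakP D := by
    linarith
  -- `‖mainMV − 𝔞·M₇·𝔓‖ ≤ 4(ε/24)𝔓 = (ε/6)𝔓`
  set M₇ : ℂ := 1 / 2 * d7F 1 (yyJ1 1) (yyJ2 1) + 2 * d7F 2 (yyJ1 2) (yyJ2 2) +
    3 / 2 * d7F 3 (yyJ1 3) (yyJ2 3) with hM₇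
  have hcomb := combination_eval (A := frakA χ) hα
    (hSD hA 1 (by simp)) (hSD hA 2 (by simp)) (hSD hA 3 (by simp))
  have e6 : ‖mainMV c' D (a23 χ) (a23 χ) - (frakA χ : ℂ) * M₇ * frakP D‖ ≤ ε / 6 * frakP D := by
    have emv : mainMV c' D (a23 χ) (a23 χ) - (frakA χ : ℂ) * M₇ * frakP D =
        ((alpha D : ℂ)⁻¹ * (1 / 2 * Sj c' D 1 (a23 χ) (a23 χ) + 2 * Sj c' D 2 (a23 χ) (a23 χ) +
            3 / 2 * Sj c' D 3 (a23 χ) (a23 χ)) - (frakA χ : ℂ) * M₇) * frakP D := by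
      rw [mainMV, hM₇]; ring
    rw [emv, norm_mul, Complex.norm_real, Real.norm_eq_abs, abs_of_nonneg hP]
    calc _ ≤ 4 * (ε / 24) * frakP D := mul_le_mul_of_nonneg_right hcomb hP
      _ = ε / 6 * frakP D := by ring
  -- the real parts: `2Re(𝔞·M₇·𝔓) = C233·𝔞𝔓`
  have hre : 2 * ((frakA χ : ℂ) * M₇ * frakP D).re = C233 * frakA χ * frakP D := by
    have : ((frakA χ : ℂ) * M₇ * frakP D).re = frakA χ * M₇.re * frakP D := by
      simp [Complex.mul_re, Complex.ofReal_re, Complex.ofReal_im]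
    rw [this, ← combination_d7F_re_eq_C233, ← hM₇]
    ring
  -- assemble
  have k1 : |(Theta1 c' χ (a23 χ) (a23 χ)).re - ((frakA χ : ℂ) * M₇ * frakP D).re| ≤
      ε / 6 * frakP D + ε / 6 * frakP D := by
    have := Complex.abs_re_le_norm (Theta1 c' χ (a23 χ) (a23 χ) - (frakA χ : ℂ) * M₇ * frakP D)
    rw [Complex.sub_re] at this
    refine this.trans ?_
    calc ‖Theta1 c' χ (a23 χ) (a23 χ) - (frakA χ : ℂ) * M₇ * frakP D‖
        ≤ ‖Theta1 c' χ (a23 χ) (a23 χ) - mainMV c' D (a23 χ) (a23 χ)‖ +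
            ‖mainMV c' D (a23 χ) (a23 χ) - (frakA χ : ℂ) * M₇ * frakP D‖ := norm_sub_le_norm_sub_add_norm_sub _ _ _
      _ ≤ ε / 6 * frakP D + ε / 6 * frakP D := add_le_add e5 e6
  have k2 := h183D hA
  have k3 : |xiJ c' χ - C233 * frakA χ * frakP D| ≤
      |xiJ c' χ - 2 * (Theta1 c' χ (a23 χ) (a23 χ)).re| +
        2 * |(Theta1 c' χ (a23 χ) (a23 χ)).re - ((frakA χ : ℂ) * M₇ * frakP D).re| := by
    rw [← hre]
    have e : xiJ c' χ - 2 * ((frakA χ : ℂ) * M₇ * frakP D).re =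
        (xiJ c' χ - 2 * (Theta1 c' χ (a23 χ) (a23 χ)).re) +
          2 * ((Theta1 c' χ (a23 χ) (a23 χ)).re - ((frakA χ : ℂ) * M₇ * frakP D).re) := by ring
    rw [e]
    refine (abs_add_le _ _).trans ?_
    rw [abs_mul, abs_two]
  calc |xiJ c' χ - C233 * frakA χ * frakP D|
      ≤ |xiJ c' χ - 2 * (Theta1 c' χ (a23 χ) (a23 χ)).re| +
          2 * |(Theta1 c' χ (a23 χ) (a23 χ)).re - ((frakA χ : ℂ) * M₇ * frakP D).re| := k3
    _ ≤ ε / 3 * frakP D + 2 * (ε / 6 * frakP D + ε / 6 * frakP D) := by gcongr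
    _ = ε * frakP D := by ring

/-- **The sharp (18.3)-bound shape** from the two-sided evaluation: `Ξ_J ≤ C₂₃₃𝔞𝔓 + ε𝔓` eventually —
the `C233` twin of `Skeleton.Bound183` (which is the `8800/π` instance). [cite: Zhang2022LandauSiegel, §18 p.100, (18.3)] -/
theorem bound183With_C233_of_eval
    (h : ∀ ε : ℝ, 0 < ε → ForAllLarge fun D _ χ => AssumptionA D χ →
      |xiJ c' χ - C233 * frakA χ * frakP D| ≤ ε * frakP D) :
    ∀ ε : ℝ, 0 < ε → ForAllLarge fun D _ χ => AssumptionA D χ →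
      xiJ c' χ ≤ C233 * frakA χ * frakP D + ε * frakP D := by
  intro ε hε
  refine (h ε hε).mono ?_
  intro D _ χ _ _ hD hA
  have := (abs_le.mp (hD hA)).2
  linarith

/-! ## The cone over the relative Lemma 10.2: the same from `Eq183`, `Prop71`, `Lemma101` and the
two relative clause bundles, and from `Skeleton.Lemma102RelW` -/

section ConeRel

/-- **`|Ξ_J − C₂₃₃𝔞𝔓| ≤ ε𝔓` from (18.3), Proposition 7.1, Lemma 10.1 and the RELATIVE Lemma 10.2**
(clauses (10.8)–(10.10) relative with weight `(∏_{q∣dr}(1−q⁻¹)⁻¹)²`, window clause at rate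
`𝓛^{−18/5}`): the range claims come from `step18_range1_of_rel`, `step18_u010_of_rel`,
`step18_u011b_of_rel` (Section18RangeEdgesRelW), u008/u009/u012 are tree theorems, the error-term
control is `ecal23Negligible_of_sjNorm ∘ sjNorm_of_ranges`. [cite: Zhang2022LandauSiegel, §18 p.100, (18.3), (2.33)] -/
theorem xiJ_eval_C233_of_rel (h183 : Skeleton.Eq183 c') (h71 : Skeleton.Prop71 c')
    (h101 : Skeleton.Lemma101 c')
    (hmain : ∃ C : ℝ, ForAllLarge fun D _ χ => AssumptionA D χ →
      ∀ j ∈ ({1, 2, 3} : Finset ℕ), ∀ d r : ℕ, 1 ≤ d → 1 ≤ r →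
        (((d * r : ℕ) : ℝ) ≤ bigP D ^ (0.5 : ℝ) / bigT D →
          ‖frakv2 c' χ j d r - deriv χ.LFunction 1 * PiW χ d r / 500 *
            (betaJ c' D (j + 1) * betaJ c' D (j + 2)) * Real.log (bigP D)‖ ≤
              C * (ell D ^ 15)⁻¹ * (∏ q ∈ (d * r).primeFactors, (1 - (q : ℝ)⁻¹)⁻¹) ^ 2) ∧
        (bigP D ^ (0.5 : ℝ) < ((d * r : ℕ) : ℝ) → ((d * r : ℕ) : ℝ) ≤ bigP D ^ (0.502 : ℝ) / bigT D →
          ‖frakv2 c' χ j d r - 500 * deriv χ.LFunction 1 * PiW χ d r / Real.log (bigP D) *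
            (-1 + fraky1 c' D j ((d * r : ℕ) : ℝ))‖ ≤
              C * (ell D ^ 15)⁻¹ * (∏ q ∈ (d * r).primeFactors, (1 - (q : ℝ)⁻¹)⁻¹) ^ 2) ∧
        (bigP D ^ (0.502 : ℝ) < ((d * r : ℕ) : ℝ) →
          ((d * r : ℕ) : ℝ) ≤ bigP D ^ (0.504 : ℝ) / bigT D →
          ‖frakv2 c' χ j d r - 500 * deriv χ.LFunction 1 * PiW χ d r / Real.log (bigP D) *
            (1 + fraky2 c' D j ((d * r : ℕ) : ℝ))‖ ≤
              C * (ell D ^ 15)⁻¹ * (∏ q ∈ (d * r).primeFactors, (1 - (q : ℝ)⁻¹)⁻¹) ^ 2))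
    (hwin : ∃ C : ℝ, ForAllLarge fun D _ χ => AssumptionA D χ →
      ∀ j ∈ ({1, 2, 3} : Finset ℕ), ∀ d r : ℕ, 1 ≤ d → 1 ≤ r →
        ((bigP D ^ (0.5 : ℝ) / bigT D < ((d * r : ℕ) : ℝ) ∧ ((d * r : ℕ) : ℝ) ≤ bigP D ^ (0.5 : ℝ)) ∨
            (bigP D ^ (0.502 : ℝ) / bigT D < ((d * r : ℕ) : ℝ) ∧
              ((d * r : ℕ) : ℝ) ≤ bigP D ^ (0.502 : ℝ)) ∨
            (bigP D ^ (0.504 : ℝ) / bigT D < ((d * r : ℕ) : ℝ) ∧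
              ((d * r : ℕ) : ℝ) < bigP D ^ (0.504 : ℝ)) →
          ‖frakv2 c' χ j d r‖ ≤
            C * (ell D ^ (18 / 5 : ℝ))⁻¹ * (∏ q ∈ (d * r).primeFactors, (1 - (q : ℝ)⁻¹)⁻¹) ^ 2)) :
    ∀ ε : ℝ, 0 < ε → ForAllLarge fun D _ χ => AssumptionA D χ →
      |xiJ c' χ - C233 * frakA χ * frakP D| ≤ ε * frakP D :=
  xiJ_eval_C233_of_steps c' h183 h71
    (sj23_eval_of_ranges c' (step18_u008_holds c') (step18_u009_holds c')
      (step18_range1_of_rel c' h101 hmain hwin) (step18_u010_of_rel c' h101 hmain hwin)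
      (step18_u011b_of_rel c' h101 hmain hwin))
    (Sec18Ded183.ecal23Negligible_of_sjNorm c'
      (sjNorm_of_ranges c' (step18_u008_holds c') (step18_u009_holds c')
        (step18_range1_of_rel c' h101 hmain hwin) (step18_u010_of_rel c' h101 hmain hwin)
        (step18_u011b_of_rel c' h101 hmain hwin) (step18_u012_holds c')))

/-- Eventually `𝓛 ≥ K`. [folklore] -/
private theorem exists_ell_ge'' (K : ℝ) : ∃ D₁ : ℕ, ∀ D : ℕ, D₁ ≤ D → K ≤ ell D := by
  obtain ⟨D₁, h⟩ := Filter.eventually_atTop.mp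
    ((Real.tendsto_log_atTop.comp tendsto_natCast_atTop_atTop).eventually (Filter.eventually_ge_atTop K))
  exact ⟨D₁, fun D hD => h D hD⟩

/-- The D3 window rate is of the shape `𝓛^{−18/5}`: for `L ≥ 1` and `R ≥ 0`,
`C·L·(1 + L^{1.1})⁴/L⁹·R ≤ 16·max(C,0)·L^{−18/5}·R` (`(1 + L^{1.1})⁴ ≤ 16L^{4.4}`, `1 + 4.4 + 3.6 = 9`;
private copy of the helper in `Section18RangeEdgesRelW`). [folklore] -/
private theorem d3_rate_le' {C L R t : ℝ} (hL : 1 ≤ L) (hR : 0 ≤ R)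
    (ht : t ≤ C * L * (1 + L ^ (1.1 : ℝ)) ^ 4 / L ^ 9 * R) :
    t ≤ 16 * max C 0 * (L ^ (18 / 5 : ℝ))⁻¹ * R := by
  have hL0 : 0 < L := by linarith
  have hu1 : 1 ≤ L ^ (1.1 : ℝ) := Real.one_le_rpow hL (by norm_num)
  have hu0 : 0 ≤ L ^ (1.1 : ℝ) := by linarith
  have h185 : 0 < L ^ (18 / 5 : ℝ) := Real.rpow_pos_of_pos hL0 _
  have hsplit : L * (L ^ (1.1 : ℝ)) ^ 4 * L ^ (18 / 5 : ℝ) = L ^ 9 := by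
    have e1 : (L ^ (1.1 : ℝ)) ^ 4 = L ^ ((1.1 : ℝ) * 4) := by
      rw [← Real.rpow_natCast (L ^ (1.1 : ℝ)) 4, ← Real.rpow_mul hL0.le]
      norm_num
    have e2 : L = L ^ (1 : ℝ) := (Real.rpow_one L).symm
    rw [e1]
    conv_lhs => rw [e2]
    rw [← Real.rpow_mul hL0.le, ← Real.rpow_mul hL0.le, ← Real.rpow_add hL0, ← Real.rpow_add hL0,
      ← Real.rpow_natCast L 9]
    norm_num
  have h4 : (1 + L ^ (1.1 : ℝ)) ^ 4 ≤ 16 * (L ^ (1.1 : ℝ)) ^ 4 := by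
    have : 1 + L ^ (1.1 : ℝ) ≤ 2 * L ^ (1.1 : ℝ) := by linarith
    calc (1 + L ^ (1.1 : ℝ)) ^ 4 ≤ (2 * L ^ (1.1 : ℝ)) ^ 4 := pow_le_pow_left₀ (by linarith) this 4
      _ = 16 * (L ^ (1.1 : ℝ)) ^ 4 := by ring
  have key : L * (1 + L ^ (1.1 : ℝ)) ^ 4 / L ^ 9 ≤ 16 * (L ^ (18 / 5 : ℝ))⁻¹ := by
    rw [div_le_iff₀ (by positivity)]
    calc L * (1 + L ^ (1.1 : ℝ)) ^ 4 ≤ L * (16 * (L ^ (1.1 : ℝ)) ^ 4) :=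
          mul_le_mul_of_nonneg_left h4 hL0.le
      _ = 16 * (L ^ (18 / 5 : ℝ))⁻¹ * (L * (L ^ (1.1 : ℝ)) ^ 4 * L ^ (18 / 5 : ℝ)) := by
          field_simp
      _ = 16 * (L ^ (18 / 5 : ℝ))⁻¹ * L ^ 9 := by rw [hsplit]
  refine ht.trans ?_
  have hC : C * L * (1 + L ^ (1.1 : ℝ)) ^ 4 / L ^ 9 ≤ max C 0 * (L * (1 + L ^ (1.1 : ℝ)) ^ 4 / L ^ 9) := by
    have h0 : 0 ≤ L * (1 + L ^ (1.1 : ℝ)) ^ 4 / L ^ 9 := by positivity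
    calc C * L * (1 + L ^ (1.1 : ℝ)) ^ 4 / L ^ 9 = C * (L * (1 + L ^ (1.1 : ℝ)) ^ 4 / L ^ 9) := by ring
      _ ≤ max C 0 * (L * (1 + L ^ (1.1 : ℝ)) ^ 4 / L ^ 9) :=
          mul_le_mul_of_nonneg_right (le_max_left _ _) h0
  calc C * L * (1 + L ^ (1.1 : ℝ)) ^ 4 / L ^ 9 * R
      ≤ max C 0 * (L * (1 + L ^ (1.1 : ℝ)) ^ 4 / L ^ 9) * R := mul_le_mul_of_nonneg_right hC hR
    _ ≤ max C 0 * (16 * (L ^ (18 / 5 : ℝ))⁻¹) * R :=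
        mul_le_mul_of_nonneg_right (mul_le_mul_of_nonneg_left key (le_max_right _ _)) hR
    _ = 16 * max C 0 * (L ^ (18 / 5 : ℝ))⁻¹ * R := by ring

/-- **The same with the window clause in the D3 text of record** (START-HERE R-26:
`‖𝔳₂ⱼ(d,r)‖ ≤ C·𝓛·(1 + log T)⁴/log P·(∏_{q∣dr}(1−q⁻¹)⁻¹)²`, the clause-4 body of
`Skeleton.Lemma102RelW`). [cite: Zhang2022LandauSiegel, §18 p.100, (18.3); §10 (10.11) p.55] -/
theorem xiJ_eval_C233_of_relD3 (h183 : Skeleton.Eq183 c') (h71 : Skeleton.Prop71 c')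
    (h101 : Skeleton.Lemma101 c')
    (hmain : ∃ C : ℝ, ForAllLarge fun D _ χ => AssumptionA D χ →
      ∀ j ∈ ({1, 2, 3} : Finset ℕ), ∀ d r : ℕ, 1 ≤ d → 1 ≤ r →
        (((d * r : ℕ) : ℝ) ≤ bigP D ^ (0.5 : ℝ) / bigT D →
          ‖frakv2 c' χ j d r - deriv χ.LFunction 1 * PiW χ d r / 500 *
            (betaJ c' D (j + 1) * betaJ c' D (j + 2)) * Real.log (bigP D)‖ ≤
              C * (ell D ^ 15)⁻¹ * (∏ q ∈ (d * r).primeFactors, (1 - (q : ℝ)⁻¹)⁻¹) ^ 2) ∧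
        (bigP D ^ (0.5 : ℝ) < ((d * r : ℕ) : ℝ) → ((d * r : ℕ) : ℝ) ≤ bigP D ^ (0.502 : ℝ) / bigT D →
          ‖frakv2 c' χ j d r - 500 * deriv χ.LFunction 1 * PiW χ d r / Real.log (bigP D) *
            (-1 + fraky1 c' D j ((d * r : ℕ) : ℝ))‖ ≤
              C * (ell D ^ 15)⁻¹ * (∏ q ∈ (d * r).primeFactors, (1 - (q : ℝ)⁻¹)⁻¹) ^ 2) ∧
        (bigP D ^ (0.502 : ℝ) < ((d * r : ℕ) : ℝ) →
          ((d * r : ℕ) : ℝ) ≤ bigP D ^ (0.504 : ℝ) / bigT D →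
          ‖frakv2 c' χ j d r - 500 * deriv χ.LFunction 1 * PiW χ d r / Real.log (bigP D) *
            (1 + fraky2 c' D j ((d * r : ℕ) : ℝ))‖ ≤
              C * (ell D ^ 15)⁻¹ * (∏ q ∈ (d * r).primeFactors, (1 - (q : ℝ)⁻¹)⁻¹) ^ 2))
    (hwinD3 : ∃ C : ℝ, ForAllLarge fun D _ χ => AssumptionA D χ →
      ∀ j ∈ ({1, 2, 3} : Finset ℕ), ∀ d r : ℕ, 1 ≤ d → 1 ≤ r →
        ((bigP D ^ (0.5 : ℝ) / bigT D < ((d * r : ℕ) : ℝ) ∧ ((d * r : ℕ) : ℝ) ≤ bigP D ^ (0.5 : ℝ)) ∨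
            (bigP D ^ (0.502 : ℝ) / bigT D < ((d * r : ℕ) : ℝ) ∧
              ((d * r : ℕ) : ℝ) ≤ bigP D ^ (0.502 : ℝ)) ∨
            (bigP D ^ (0.504 : ℝ) / bigT D < ((d * r : ℕ) : ℝ) ∧
              ((d * r : ℕ) : ℝ) < bigP D ^ (0.504 : ℝ)) →
          ‖frakv2 c' χ j d r‖ ≤
            C * ell D * (1 + Real.log (bigT D)) ^ 4 / Real.log (bigP D) *
              (∏ q ∈ (d * r).primeFactors, (1 - (q : ℝ)⁻¹)⁻¹) ^ 2)) :
    ∀ ε : ℝ, 0 < ε → ForAllLarge fun D _ χ => AssumptionA D χ →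
      |xiJ c' χ - C233 * frakA χ * frakP D| ≤ ε * frakP D := by
  obtain ⟨C, D₀, h⟩ := hwinD3
  obtain ⟨D₁, hD₁⟩ := exists_ell_ge'' 1
  refine xiJ_eval_C233_of_rel c' h183 h71 h101 hmain
    ⟨16 * max C 0, max D₀ D₁, fun D _ χ hD hq hp hA j hj d r hd hr hw => ?_⟩
  have h' := h D χ (le_trans (le_max_left _ _) hD) hq hp hA j hj d r hd hr hw
  have hL1 : 1 ≤ ell D := hD₁ D (le_trans (le_max_right _ _) hD)
  rw [log_bigT, log_bigP] at h'
  exact d3_rate_le' hL1 (sq_nonneg _) h'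

/-- **`|Ξ_J − C₂₃₃𝔞𝔓| ≤ ε𝔓` from the four antecedents of `Skeleton.Ded183RelW`** — (18.3) `Eq183`,
Proposition 7.1, Lemma 10.1, and Lemma 10.2 in the relative-weighted reading of record
`Skeleton.Lemma102RelW` (RT-01′; a THEOREM in the tree, `lemma102RelW_of_lemma83Rel`) — for every `c′`:
(2.33)'s left side evaluated with §18's own main-term constant. [cite: Zhang2022LandauSiegel, §18 pp.99–101, (18.3), (2.33)] -/
theorem _root_.Literature.NumberTheory.LFunctions.Zhang2022.Skeleton.xiJ_evalC233_of_lemma102RelW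
    (h183 : Skeleton.Eq183 c') (h71 : Skeleton.Prop71 c') (h101 : Skeleton.Lemma101 c')
    (h102 : Skeleton.Lemma102RelW c') :
    ∀ ε : ℝ, 0 < ε → ForAllLarge fun D _ χ => AssumptionA D χ →
      |xiJ c' χ - C233 * frakA χ * frakP D| ≤ ε * frakP D := by
  obtain ⟨C, D₀, h⟩ := h102
  refine xiJ_eval_C233_of_relD3 c' h183 h71 h101 ⟨C, D₀, fun D _ χ hD hq hp hA j hj d r hd hr => ?_⟩
    ⟨C, D₀, fun D _ χ hD hq hp hA j hj d r hd hr hw => (h D χ hD hq hp hA j hj d r hd hr).2.2.2 hw⟩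
  have h' := h D χ hD hq hp hA j hj d r hd hr
  exact ⟨h'.1, h'.2.1, h'.2.2.1⟩

/-- **The sharp (18.3) bound `Ξ_J ≤ C₂₃₃𝔞𝔓 + ε𝔓`** (the `C233` twin of `Skeleton.Bound183`, whose
constant is the printed crude `8800/π`) from the four antecedents of `Skeleton.Ded183RelW`, every `c′`.
[cite: Zhang2022LandauSiegel, §18 pp.99–101, (18.3)] -/
theorem _root_.Literature.NumberTheory.LFunctions.Zhang2022.Skeleton.bound183With_C233
    (h183 : Skeleton.Eq183 c') (h71 : Skeleton.Prop71 c') (h101 : Skeleton.Lemma101 c')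
    (h102 : Skeleton.Lemma102RelW c') :
    ∀ ε : ℝ, 0 < ε → ForAllLarge fun D _ χ => AssumptionA D χ →
      xiJ c' χ ≤ C233 * frakA χ * frakP D + ε * frakP D :=
  bound183With_C233_of_eval c' (Skeleton.xiJ_evalC233_of_lemma102RelW c' h183 h71 h101 h102)

/-- **The RT-08 node of record at the sharp constant: `Skeleton.Ineq233With c′ C233`** — for every
`η > 0`, eventually under (A), `Ξ_J ≤ (C₂₃₃ + η)𝔞𝔓` — from `Eq183`, `Prop71`, `Lemma101`,
`Skeleton.Lemma102RelW` (the same four antecedents as `Skeleton.Ded183RelW`, so the skeleton plugs it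
with the terms it already builds), via the endgame's `ineq233With_of_bound` and Lemma 5.7
(`frakALowerBound_holds`, `𝔞 ≥ a₀ > 0`). vs PRINT: STRONGER than the printed-crude instance
`Ineq233With c′ (8800/π)` (`C₂₃₃ ≈ 2546.85 < 2801.1 ≈ 8800/π`) and exactly §18's displayed computation.
[cite: Zhang2022LandauSiegel, §18 pp.99–101, (2.33)] -/
theorem _root_.Literature.NumberTheory.LFunctions.Zhang2022.Skeleton.ineq233With_C233
    (h183 : Skeleton.Eq183 c') (h71 : Skeleton.Prop71 c') (h101 : Skeleton.Lemma101 c')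
    (h102 : Skeleton.Lemma102RelW c') : Skeleton.Ineq233With c' C233 :=
  ineq233With_of_bound (Skeleton.bound183With_C233 c' h183 h71 h101 h102) frakALowerBound_holds

end ConeRel

/-! ## The node of record fully plugged: `Ineq233With c′ C233` from Proposition 2.2 alone

Revision 2 (same session): every antecedent of `Skeleton.ineq233With_C233` is a tree theorem given
Proposition 2.2 at `c′` and `0 ≤ c′` — (18.3) `eq183_of` (from Prop 2.2 (i), Lemma 2.3 `ded23_holds`,
Lemma 8.1 `lemma81_of_prop22`), Proposition 7.1 `Section7cStatements.prop71X_holds`, Lemma 10.1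
`lemma101_holds`, Lemma 10.2 (RT-01′) `lemma102RelW_of_lemma83Rel (lemma83Rel_holds c′)` — so the
skeleton's cJ := C233 swap (R-35d) is ONE term wherever `hc′ : 0 ≤ c′` and `h22 : Prop22 c′` are in
scope (both are, inside `sec2_inputs_of_leaves_v2x`). -/

section Plugged

/-- **`Skeleton.Ineq233With c′ C233` from `0 ≤ c′` and Proposition 2.2 at `c′` alone** — the (2.33)
node of record at §18's own main-term constant, with (18.3), Prop. 7.1, Lemmas 10.1–10.2 (RT-01′) all
supplied by tree theorems: `Skeleton.ineq233With_C233 c′ (eq183_of h22.1 (ded23_holds hc′ h22)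
(lemma81_of_prop22 hc′ h22)) (prop71X_holds c′) (lemma101_holds hc′) (lemma102RelW_of_lemma83Rel
(lemma83Rel_holds c′))`. [cite: Zhang2022LandauSiegel, §18 pp.99–101, (2.33)] -/
theorem _root_.Literature.NumberTheory.LFunctions.Zhang2022.Skeleton.ineq233With_C233_of_prop22
    {c' : ℝ} (hc' : 0 ≤ c') (h22 : Skeleton.Prop22 c') : Skeleton.Ineq233With c' C233 :=
  Skeleton.ineq233With_C233 c'
    (Skeleton.eq183_of h22.1 (Skeleton.ded23_holds hc' h22) (Skeleton.lemma81_of_prop22 hc' h22))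
    (Section7cStatements.prop71X_holds c') (Skeleton.lemma101_holds hc')
    (Skeleton.lemma102RelW_of_lemma83Rel (Skeleton.lemma83Rel_holds c'))

/-- The two-sided evaluation fully plugged: `|Ξ_J − C₂₃₃𝔞𝔓| ≤ ε𝔓` eventually under (A), from
`0 ≤ c′` and Proposition 2.2 at `c′` (the non-vacuous content; exported for the companion's T18-4
list). [cite: Zhang2022LandauSiegel, §18 pp.99–101, (18.3)] -/
theorem _root_.Literature.NumberTheory.LFunctions.Zhang2022.Skeleton.xiJ_evalC233_of_prop22
    {c' : ℝ} (hc' : 0 ≤ c') (h22 : Skeleton.Prop22 c') :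
    ∀ ε : ℝ, 0 < ε → ForAllLarge fun D _ χ => AssumptionA D χ →
      |xiJ c' χ - C233 * frakA χ * frakP D| ≤ ε * frakP D :=
  Skeleton.xiJ_evalC233_of_lemma102RelW c'
    (Skeleton.eq183_of h22.1 (Skeleton.ded23_holds hc' h22) (Skeleton.lemma81_of_prop22 hc' h22))
    (Section7cStatements.prop71X_holds c') (Skeleton.lemma101_holds hc')
    (Skeleton.lemma102RelW_of_lemma83Rel (Skeleton.lemma83Rel_holds c'))

end Plugged

end Literature.NumberTheory.LFunctions.Zhang2022.Typed.Section18
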